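import Summits.BirchSwinnertonDyer.BirchSwinnertonDyer.Theorems.SoloInformedNullPlaneRank

/-!
# SoloInformedFineHeight — the critical-slope input is the FINE HEIGHT of the Gross–Zagier lattice

`SoloInformedHeightPencil` attached to excess rank `rank E(ℚ) > r_an = r` (granted the two slope
identities with their Kato-type bounds) the condition `(R_αβ)_p`: the Gram matrices of BOTH members
`D₁`, `D₂ = D₁ - t·ℓ⊗ℓ` (`t ≠ 0`, `ℓ = log_ω`) of the pencil of `p`-adic heights vanish on the
Gross–Zagier family `P`. This file isolates what the SECOND slope adds.

* FINE FORM. On `ker(x ↦ Σ xᵢ ℓ(Pᵢ))` all members of the pencil agree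
  (`soloInformedFine_member_iff`); the restriction of `B = [⟨Pᵢ,Pⱼ⟩_{D₁}]` to it is the fine height
  pairing of the family (the height on the part of `Π ⊗ ℤ_p`, `Π = Σ ℤPᵢ`, killed in `E(ℚ_p) ⊗ ℚ_p`
  — the fine Mordell–Weil group of `Π` in Wuthrich's sense); `soloFineRadical B v` is its
  radical. SYMMETRIC PENCIL, FINE VERSION (`soloInformedFine_pencil_iff`, any `r`, `t ≠ 0`):
  `det B = 0 ∧ det (B - t·v vᵀ) = 0 ↔ det B = 0 ∧ soloFineRadical B v ≠ 0`.
* TWO POINTS (`soloInformedFine_det_member_fin_two`, the matrix determinant lemma for a `2 × 2`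
  pencil): `det (B - s·v vᵀ) = det B - s·F`, `F = wᵀ B w`, `w = (v₁, -v₀)` spanning `ker v`.
  Height-data form (`soloInformedFine_regulator_pencil`): `Reg_{D₂}(P) = Reg_{D₁}(P) - t·FH_{D₁}(P)`
  with the FINE HEIGHT `FH_D(P)` = the `ĥ_D`-value of the formal combination `ℓ(P₁)·P₀ - ℓ(P₀)·P₁`
  (`soloFineHeightOf`; pencil-independent, `soloInformedFine_pencil_indep`); so
  `(R_αβ)_p ↔ Reg_{D₁}(P) = 0 ∧ FH(P) = 0` (`soloInformedFine_iff`).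
* CERTIFICATE (`soloInformedFine_rank_eq_two`; any `r`: `soloInformedFine_rank_eq`): with the data
  of `soloInformedPencil_rank_eq` at `r = 2`, `FH_{D₁}(P) ≠ 0` at ONE good ordinary `p` gives
  `rank E(ℚ) = 2 ∧ corank Ш[p^∞] = 0` with NO hypothesis on the canonical regulator (if
  `Reg_{D₁} = 0` then `Reg_{D₂} = -t·FH ≠ 0`). EXCESS RANK (`soloInformedFine_of_lt`):
  `rank E(ℚ) > 2` forces `Reg_{D₁}(P) = 0` AND `FH(P) = 0` at every good ordinary `p ≥ 5`.

Reading for the summit (`BirchSwinnertonDyer`, documentation only). With `D₁` canonical and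
`ℓ = log_ω`, [MazurSteinTate2006, (1.1)] `ĥ_p(Q) = p⁻¹·log_p(σ_p(Q)/d(Q))` for `Q = (a/d², b/d³)`
in the good subgroup `Π_good` (finite index in `Π`), where `σ_p(Q) = σ_p(z_Q)`, `z_Q := log_ω(Q)`
and `σ_p(z) = z·exp(Σ_{k≥1} c_k z^{2k})` is odd in the formal LOGARITHM `z` [ibid., Alg. 3.1
steps 4–5], not in `t = -x/y = -ad/b` (`z = t + (a₁/2)t² + …`). So, with `N = v_p(d(Q)) = v_p(z_Q)`
`≥ 1`: `p·ĥ_p(Q) = log_p(z_Q/d(Q)) + O(p^{2N}) = log_p(a/b) + (a₁/2)·t_Q + O(p^{2N})`, in particular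
`= log_p(a/b) + O(p^N)` (s8 correction of the earlier `O(p^{2N})` here, true iff `p ∣ a₁`; job
j032063: `v_p(L(2Q) - 4L(Q))`, `L := log_p(a/b)`, is `N` on 433a1, 446d1 (`a₁ = 1`), `> 2N` on 389a1).
Along integer combinations `Q_k ∈ Π_good` converging `p`-adically to the kernel direction of
`log_ω` on `Π_good ⊗ ℤ_p` (`N(Q_k) → ∞`) this gives the σ-FREE formula `FH_p ≐ lim_k`
`log_p(a(Q_k)/b(Q_k))` (up to the non-zero factor `ℓ(P₀)²/p`) — a `p`-adic limit of logarithms of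
RATIONAL numbers; and with `p^{N₀}` the least formal-group level met by `Π_good` (`N₀ = 1`
generically) the valuation count, which needs the formula only modulo `p^{N - N₀ + 1}`, gives:
`FH_p ≠ 0 ↔` for some `Q ∈ Π_good`, `(a(Q)/b(Q))^{p-1} ≢ 1 (mod p^{v_p(d(Q)) - N₀ + 1})`. So
the weakest transcendence input of the two-slope mechanism is an elementary non-Wieferich condition
on ONE point of the Gross–Zagier lattice at ONE ordinary prime, and a counterexample to RANK
compatible with the receptacles would be a rank-two lattice of rational points that is "Wieferich to
all orders" (`a(Q)^{p-1} ≡ b(Q)^{p-1} mod p^{v_p(d(Q)) - N₀ + 1}` for every `Q ∈ Π_good`) at EVERY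
good ordinary prime. Nothing here constructs a height or asserts a conjecture: `B`, `v`, `D₁`, `D₂`,
`ℓ`, `t` are parameters; this paragraph is a reading, proved in the seat's paper, not in Lean.
-/

noncomputable section
open scoped Classical MatrixGroups ModularForm
open CongruenceSubgroup Literature.NumberTheory.EllipticCurves
  Literature.NumberTheory.EllipticCurves.ModularForms WeierstrassCurve WeierstrassCurve.Affine.Point
  Matrix

namespace Summit.BirchSwinnertonDyer.BirchSwinnertonDyer.Theorems

section LinearAlgebra

variable {ι : Type*} [Fintype ι] {K : Type*} [Field K]

/-- The FINE RADICAL of `B` relative to `v`: the vectors of `ker(v·)` that are `B`-orthogonal to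
all of `ker(v·)`; the fine form (`B` restricted to `ker(v·)`) is degenerate iff it has a non-zero
element. (Gram matrix of a height on a family `P`, `v = (log_ω Pᵢ)ᵢ`: the radical of the fine
height pairing of the family.) [folklore] -/
def soloFineRadical (B : Matrix ι ι K) (v : ι → K) : Set (ι → K) :=
  {x | v ⬝ᵥ x = 0 ∧ ∀ y : ι → K, v ⬝ᵥ y = 0 → y ⬝ᵥ B *ᵥ x = 0}

/-- PENCIL INDEPENDENCE: on `ker(v·)` every member `B - s·v vᵀ` acts as `B`, so all members have
the same fine radical. [folklore] -/
theorem soloInformedFine_radical_member (B : Matrix ι ι K) (v : ι → K) (s : K) :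
    soloFineRadical (B - s • vecMulVec v v) v = soloFineRadical B v := by
  ext x
  simp only [soloFineRadical, Set.mem_setOf_eq]
  refine and_congr_right fun hvx => forall_congr' fun y => imp_congr_right fun _ => ?_
  rw [soloInformedPencil_member_mulVec, hvx, mul_zero, zero_smul, sub_zero]

/-- A common radical vector (`B x = 0`, `v·x = 0`) lies in the fine radical. [folklore] -/
theorem soloInformedFine_mem_of_common_radical (B : Matrix ι ι K) (v : ι → K) {x : ι → K}
    (hBx : B *ᵥ x = 0) (hvx : v ⬝ᵥ x = 0) : x ∈ soloFineRadical B v :=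
  ⟨hvx, fun y _ => by rw [hBx, dotProduct_zero]⟩

/-- Conversely: for `B` symmetric and SINGULAR a non-zero fine-radical vector yields a common
radical vector (a kernel vector `z` of `B` lies in `ker v`, or spans a complement of it and then the
fine-radical `x` is `B`-orthogonal to `ker v` and, by symmetry, to `z`). [folklore] -/
theorem soloInformedFine_common_radical (B : Matrix ι ι K) (hB : Bᵀ = B) (v : ι → K)
    (hF : ∃ x ∈ soloFineRadical B v, x ≠ 0) (hdet : B.det = 0) :
    ∃ x : ι → K, x ≠ 0 ∧ B *ᵥ x = 0 ∧ v ⬝ᵥ x = 0 := by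
  obtain ⟨z, hz, hBz⟩ := Matrix.exists_mulVec_eq_zero_iff.mpr hdet
  by_cases hvz : v ⬝ᵥ z = 0
  · exact ⟨z, hz, hBz, hvz⟩
  obtain ⟨x, ⟨hvx, hrad⟩, hx⟩ := hF
  refine ⟨x, hx, ?_, hvx⟩
  have hzx : z ⬝ᵥ B *ᵥ x = 0 := by
    have hsym : z ⬝ᵥ B *ᵥ x = x ⬝ᵥ B *ᵥ z := by
      conv_lhs => rw [← hB]
      exact dotProduct_transpose_mulVec B z x
    rw [hsym, hBz, dotProduct_zero]
  have hall : ∀ y : ι → K, y ⬝ᵥ B *ᵥ x = 0 := fun y => by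
    have hk : v ⬝ᵥ (y - (v ⬝ᵥ y / v ⬝ᵥ z) • z) = 0 := by
      rw [dotProduct_sub, dotProduct_smul, smul_eq_mul, div_mul_cancel₀ _ hvz, sub_self]
    have h0 := hrad _ hk
    rwa [sub_dotProduct, smul_dotProduct, smul_eq_mul, hzx, mul_zero, sub_zero] at h0
  ext i
  have h1 := hall (Pi.single i 1)
  rwa [single_dotProduct, one_mul] at h1

/-- **Symmetric pencil lemma, fine version** (any number of points). For `B` symmetric and `t ≠ 0`:
BOTH members `B`, `B - t·v vᵀ` are singular iff `B` is singular AND its fine radical is non-zero.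
The second member contributes exactly the degeneracy of the fine form. [folklore] -/
theorem soloInformedFine_pencil_iff (B : Matrix ι ι K) (hB : Bᵀ = B) (v : ι → K) {t : K}
    (ht : t ≠ 0) :
    (B.det = 0 ∧ (B - t • vecMulVec v v).det = 0) ↔
      (B.det = 0 ∧ ∃ x ∈ soloFineRadical B v, x ≠ 0) := by
  constructor
  · rintro ⟨h0, ht0⟩
    have h0' : (B - (0 : K) • vecMulVec v v).det = 0 := by rwa [zero_smul, sub_zero]
    obtain ⟨x, hx, hBx, hvx⟩ := soloInformedPencil_common_radical B hB v ht.symm h0' ht0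
    exact ⟨h0, x, soloInformedFine_mem_of_common_radical B v hBx hvx, hx⟩
  · rintro ⟨h0, hF⟩
    obtain ⟨x, hx, hBx, hvx⟩ := soloInformedFine_common_radical B hB v hF h0
    exact ⟨h0, soloInformedPencil_det_eq_zero_of_common_radical B v hx hBx hvx t⟩

/-- Zero fine radical ⇒ no common radical vector in `ker(v·)`. [folklore] -/
theorem soloInformedFine_noRadical (B : Matrix ι ι K) (v : ι → K)
    (hF : ∀ x ∈ soloFineRadical B v, x = 0) :
    ∀ x : ι → K, B *ᵥ x = 0 → v ⬝ᵥ x = 0 → x = 0 :=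
  fun x hBx hvx => hF x (soloInformedFine_mem_of_common_radical B v hBx hvx)

/-- The FINE NUMBER of a `2 × 2` form `B` and a vector `v`: `B` evaluated at `w = (v₁, -v₀)`, the
vector spanning `ker(v·)` (both cross terms kept, no symmetry needed). [folklore] -/
def soloFineTwo (B : Matrix (Fin 2) (Fin 2) K) (v : Fin 2 → K) : K :=
  v 1 ^ 2 * B 0 0 - v 0 * v 1 * (B 0 1 + B 1 0) + v 0 ^ 2 * B 1 1

/-- `soloFineTwo B v = wᵀ B w`, `w = (v₁, -v₀)`. [folklore] -/
theorem soloInformedFine_two_eq_dotProduct (B : Matrix (Fin 2) (Fin 2) K) (v : Fin 2 → K) :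
    soloFineTwo B v = ![v 1, -v 0] ⬝ᵥ B *ᵥ ![v 1, -v 0] := by
  simp [soloFineTwo, Matrix.mulVec, dotProduct, Fin.sum_univ_two]
  ring

/-- `w = (v₁, -v₀)` lies in `ker(v·)`. [folklore] -/
theorem soloInformedFine_dotProduct_w (v : Fin 2 → K) : v ⬝ᵥ ![v 1, -v 0] = 0 := by
  simp [dotProduct, Fin.sum_univ_two]
  ring

/-- For `v ≠ 0`, `ker(v·) ⊂ K²` is the line spanned by `w = (v₁, -v₀)`. [folklore] -/
theorem soloInformedFine_ker_fin_two {v x : Fin 2 → K} (hv : v ≠ 0) (hvx : v ⬝ᵥ x = 0) :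
    ∃ a : K, x = a • ![v 1, -v 0] := by
  have hvx' : v 0 * x 0 + v 1 * x 1 = 0 := by simpa [dotProduct, Fin.sum_univ_two] using hvx
  by_cases h0 : v 0 = 0
  · have h1 : v 1 ≠ 0 := by
      intro h1
      apply hv
      ext i
      fin_cases i
      · exact h0
      · exact h1
    have hx1 : x 1 = 0 := by
      rw [h0, zero_mul, zero_add] at hvx'
      exact (mul_eq_zero.mp hvx').resolve_left h1
    refine ⟨x 0 / v 1, ?_⟩
    ext i
    fin_cases i
    · simp [div_mul_cancel₀ _ h1]
    · simp [h0, hx1]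
  · refine ⟨-x 1 / v 0, ?_⟩
    ext i
    fin_cases i
    · have e : x 0 = -x 1 / v 0 * v 1 := by
        field_simp
        linear_combination hvx'
      simpa using e
    · have e : x 1 = -x 1 / v 0 * (-v 0) := by
        field_simp
      simpa using e

/-- **Matrix determinant lemma for a `2 × 2` pencil**: `det (B - s·v vᵀ) = det B - s·(wᵀ B w)`.
The determinant is AFFINE in the slope with coefficient minus the fine number. [folklore] -/
theorem soloInformedFine_det_member_fin_two (B : Matrix (Fin 2) (Fin 2) K) (v : Fin 2 → K) (s : K) :
    (B - s • vecMulVec v v).det = B.det - s * soloFineTwo B v := by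
  simp only [Matrix.det_fin_two, Matrix.sub_apply, Matrix.smul_apply, vecMulVec_apply, smul_eq_mul,
    soloFineTwo]
  ring

/-- At two points (`v ≠ 0`) the fine radical is non-zero iff the fine number vanishes.
[folklore] -/
theorem soloInformedFine_radical_fin_two_iff (B : Matrix (Fin 2) (Fin 2) K) {v : Fin 2 → K}
    (hv : v ≠ 0) : (∃ x ∈ soloFineRadical B v, x ≠ 0) ↔ soloFineTwo B v = 0 := by
  have hw : (![v 1, -v 0] : Fin 2 → K) ≠ 0 := by
    intro hw
    apply hv
    have h1 : v 1 = 0 := by simpa using congr_fun hw 0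
    have h0 : v 0 = 0 := by simpa using congr_fun hw 1
    ext i
    fin_cases i
    · exact h0
    · exact h1
  constructor
  · rintro ⟨x, ⟨hvx, hrad⟩, hx⟩
    obtain ⟨a, rfl⟩ := soloInformedFine_ker_fin_two hv hvx
    have ha : a ≠ 0 := by
      rintro rfl
      exact hx (zero_smul _ _)
    have h0 := hrad _ (soloInformedFine_dotProduct_w v)
    rw [mulVec_smul, dotProduct_smul, smul_eq_mul, ← soloInformedFine_two_eq_dotProduct] at h0
    exact (mul_eq_zero.mp h0).resolve_left ha
  · intro hF
    refine ⟨![v 1, -v 0], ⟨soloInformedFine_dotProduct_w v, fun y hy => ?_⟩, hw⟩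
    obtain ⟨b, rfl⟩ := soloInformedFine_ker_fin_two hv hy
    rw [smul_dotProduct, smul_eq_mul, ← soloInformedFine_two_eq_dotProduct, hF, mul_zero]

end LinearAlgebra

section Pencil

variable {W : WeierstrassCurve ℚ} {p : ℕ} [Fact p.Prime]
  {D₁ D₂ : WeierstrassCurve.PAdicHeightData W p} {ℓ : W.toAffine.Point →+ ℚ_[p]} {t : ℚ_[p]}

/-- The FINE HEIGHT of the pair `P = (P₀, P₁)` for the height datum `D` and the linear form `ℓ`:
the `D`-height of the formal combination `ℓ(P₁)·P₀ - ℓ(P₀)·P₁`, whose coefficient vector spans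
`ker(x ↦ x₀ℓ(P₀) + x₁ℓ(P₁))` — the value of `⟨·,·⟩_D ⊗ ℚ_p` on the direction of `ℤP₀ + ℤP₁`
killed by `ℓ` (for `ℓ = log_ω`: by the map to `E(ℚ_p) ⊗ ℚ_p`). [folklore] -/
def soloFineHeightOf (D : WeierstrassCurve.PAdicHeightData W p) (ℓ : W.toAffine.Point →+ ℚ_[p])
    (P : Fin 2 → W.toAffine.Point) : ℚ_[p] :=
  ℓ (P 1) ^ 2 * D.pairing (P 0) (P 0) - 2 * ℓ (P 0) * ℓ (P 1) * D.pairing (P 0) (P 1) +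
    ℓ (P 0) ^ 2 * D.pairing (P 1) (P 1)

omit [Fact p.Prime] in
/-- The fine height is the fine number of the Gram matrix. [folklore] -/
theorem soloInformedFine_eq_fineTwo [Fact p.Prime] (D : WeierstrassCurve.PAdicHeightData W p)
    (ℓ : W.toAffine.Point →+ ℚ_[p]) (P : Fin 2 → W.toAffine.Point) :
    soloFineHeightOf D ℓ P = soloFineTwo (D.pairingMatrix P) (fun i => ℓ (P i)) := by
  simp only [soloFineHeightOf, soloFineTwo, WeierstrassCurve.PAdicHeightData.pairingMatrix,
    Matrix.of_apply]
  rw [D.symm (P 1) (P 0)]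
  ring

/-- **The pencil identity at two points**: `Reg_{D₂}(P) = Reg_{D₁}(P) - t·FH_{D₁}(P)` for
`D₂ = D₁ - t·ℓ⊗ℓ`. [folklore] -/
theorem soloInformedFine_regulator_pencil
    (h : ∀ P Q, D₂.pairing P Q = D₁.pairing P Q - t * ℓ P * ℓ Q) (P : Fin 2 → W.toAffine.Point) :
    padicRegulatorOf D₂ P = padicRegulatorOf D₁ P - t * soloFineHeightOf D₁ ℓ P := by
  -- `padicRegulatorOf` bakes in the classical `DecidableEq (Fin 2)`; `convert` bridges instances
  have e : ∀ D : WeierstrassCurve.PAdicHeightData W p, padicRegulatorOf D P =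
      D.pairing (P 0) (P 0) * D.pairing (P 1) (P 1) -
        D.pairing (P 0) (P 1) * D.pairing (P 1) (P 0) := fun D => by
      unfold padicRegulatorOf
      convert Matrix.det_fin_two (D.pairingMatrix P) <;> rfl
  rw [e, e, soloFineHeightOf, h, h, h, h, D₁.symm (P 1) (P 0)]
  ring

/-- The fine height is PENCIL-INDEPENDENT: `FH_{D₂}(P) = FH_{D₁}(P)` (all members of the pencil
agree on the direction killed by `ℓ`). [folklore] -/
theorem soloInformedFine_pencil_indep
    (h : ∀ P Q, D₂.pairing P Q = D₁.pairing P Q - t * ℓ P * ℓ Q) (P : Fin 2 → W.toAffine.Point) :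
    soloFineHeightOf D₂ ℓ P = soloFineHeightOf D₁ ℓ P := by
  simp only [soloFineHeightOf, h]
  ring

/-- **`(R_αβ)_p` at `r = 2`, fine form**: both Gram determinants vanish iff the first vanishes AND
the fine height vanishes (`t ≠ 0`). [folklore] -/
theorem soloInformedFine_iff (h : ∀ P Q, D₂.pairing P Q = D₁.pairing P Q - t * ℓ P * ℓ Q)
    (ht : t ≠ 0) (P : Fin 2 → W.toAffine.Point) :
    (padicRegulatorOf D₁ P = 0 ∧ padicRegulatorOf D₂ P = 0) ↔
      (padicRegulatorOf D₁ P = 0 ∧ soloFineHeightOf D₁ ℓ P = 0) := by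
  rw [soloInformedFine_regulator_pencil h]
  constructor
  · rintro ⟨h1, h2⟩
    refine ⟨h1, ?_⟩
    rw [h1, zero_sub, neg_eq_zero] at h2
    exact (mul_eq_zero.mp h2).resolve_left ht
  · rintro ⟨h1, hF⟩
    exact ⟨h1, by rw [h1, hF, mul_zero, sub_zero]⟩

/-- On a null plane (`⟨Pᵢ,Pⱼ⟩_{D₁} = μ·ℓ(Pᵢ)ℓ(Pⱼ)`) the fine height vanishes. [folklore] -/
theorem soloInformedFine_of_null (D₁ : WeierstrassCurve.PAdicHeightData W p)
    (ℓ : W.toAffine.Point →+ ℚ_[p]) (P : Fin 2 → W.toAffine.Point) {μ : ℚ_[p]}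
    (hμ : ∀ i j, D₁.pairing (P i) (P j) = μ * ℓ (P i) * ℓ (P j)) :
    soloFineHeightOf D₁ ℓ P = 0 := by
  simp only [soloFineHeightOf, hμ]
  ring

/-- A non-zero fine height excludes a common radical vector in `ker ℓ`. [folklore] -/
theorem soloInformedFine_noRadical_of_ne_zero (D₁ : WeierstrassCurve.PAdicHeightData W p)
    (ℓ : W.toAffine.Point →+ ℚ_[p]) (P : Fin 2 → W.toAffine.Point)
    (hF : soloFineHeightOf D₁ ℓ P ≠ 0) :
    ∀ x : Fin 2 → ℚ_[p], D₁.pairingMatrix P *ᵥ x = 0 → (fun i => ℓ (P i)) ⬝ᵥ x = 0 → x = 0 := by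
  have hv : (fun i => ℓ (P i)) ≠ 0 := by
    intro hv
    apply hF
    have h0 : ℓ (P 0) = 0 := congr_fun hv 0
    have h1 : ℓ (P 1) = 0 := congr_fun hv 1
    simp [soloFineHeightOf, h0, h1]
  refine soloInformedFine_noRadical _ _ fun x hx => ?_
  by_contra hx0
  apply hF
  rw [soloInformedFine_eq_fineTwo]
  exact (soloInformedFine_radical_fin_two_iff _ hv).mp ⟨x, hx, hx0⟩

/-- General family: `(R_αβ)_p` iff `Reg_{D₁}(P) = 0` and the fine height pairing of the family is
degenerate (`t ≠ 0`). [folklore] -/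
theorem soloInformedFine_family_iff (h : ∀ P Q, D₂.pairing P Q = D₁.pairing P Q - t * ℓ P * ℓ Q)
    (ht : t ≠ 0) {ι : Type*} [Fintype ι] (P : ι → W.toAffine.Point) :
    (padicRegulatorOf D₁ P = 0 ∧ padicRegulatorOf D₂ P = 0) ↔
      (padicRegulatorOf D₁ P = 0 ∧
        ∃ x ∈ soloFineRadical (D₁.pairingMatrix P) (fun i => ℓ (P i)), x ≠ 0) := by
  rw [soloInformedPencil_padicRegulatorOf_eq h]
  exact soloInformedFine_pencil_iff _ (D₁.pairingMatrix_transpose P) _ ht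

end Pencil

section OneCurve

variable (W : WeierstrassCurve ℚ) [W.IsElliptic] [W.IsGloballyMinimal] (p : ℕ) [Fact p.Prime]
  {N : ℕ} [NeZero N] (f : CuspForm (Gamma0 N) 2)

/-- **Certificate by the fine form** (any `r`). Data of `soloInformedPencil_rank_eq`; if the fine
height pairing of the family is NON-degenerate then `rank E(ℚ) = r` and `corank Ш[p^∞] = 0` — no
hypothesis on the canonical regulator itself. [cite: BuyukbodukPollackSasaki2018, Cor. 1.1.2] -/
theorem soloInformedFine_rank_eq {r : ℕ} (hE : hasEntireLFunction_rat) (hp : 5 ≤ p)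
    (hord : IsOrdinaryAt W p) (hf : IsNewformOf W f)
    (hKato : kato_selmerCorank_le_order_padicLFunction W p (f := f))
    {D₁ D₂ : WeierstrassCurve.PAdicHeightData W p} {ℓ : W.toAffine.Point →+ ℚ_[p]} {t : ℚ_[p]}
    (h : ∀ P Q, D₂.pairing P Q = D₁.pairing P Q - t * ℓ P * ℓ Q) (ht : t ≠ 0)
    (P : Fin r → W.toAffine.Point) (c : ℚ) {e₁ e₂ lg : ℚ_[p]} (he₁ : e₁ ≠ 0) (he₂ : e₂ ≠ 0)
    (L₂ : PowerSeries ℚ_[p])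
    (hL : W.leadingLCoeff = (((c : ℝ) * plusPeriod f * regulatorOf P : ℝ) : ℂ))
    (h₁ : PowerSeries.coeff r (padicLFunction f (unitRoot W p : ℚ_[p])) * lg ^ r =
      (c : ℚ_[p]) * e₁ * padicRegulatorOf D₁ P)
    (h₂ : PowerSeries.coeff r L₂ * lg ^ r = (c : ℚ_[p]) * e₂ * padicRegulatorOf D₂ P)
    (hKato₂ : (W.selmerCorank p : ℕ∞) ≤ L₂.order)
    (hF : ∀ x ∈ soloFineRadical (D₁.pairingMatrix P) (fun i => ℓ (P i)), x = 0) :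
    W.mordellWeilRank = r ∧ W.shaCorank p = 0 :=
  soloInformedPencil_rank_eq W p f hE hp hord hf hKato h ht P c he₁ he₂ L₂ hL h₁ h₂ hKato₂
    (soloInformedFine_noRadical _ _ hF)

/-- **Rank two from a non-zero fine height.** Data of `soloInformedPencil_rank_eq` at `r = 2`; if
`FH_{D₁}(P) ≠ 0` at this one good ordinary `p` then `rank E(ℚ) = 2 ∧ corank Ш[p^∞] = 0`.
[cite: BuyukbodukPollackSasaki2018, Cor. 1.1.2] -/
theorem soloInformedFine_rank_eq_two (hE : hasEntireLFunction_rat) (hp : 5 ≤ p)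
    (hord : IsOrdinaryAt W p) (hf : IsNewformOf W f)
    (hKato : kato_selmerCorank_le_order_padicLFunction W p (f := f))
    {D₁ D₂ : WeierstrassCurve.PAdicHeightData W p} {ℓ : W.toAffine.Point →+ ℚ_[p]} {t : ℚ_[p]}
    (h : ∀ P Q, D₂.pairing P Q = D₁.pairing P Q - t * ℓ P * ℓ Q) (ht : t ≠ 0)
    (P : Fin 2 → W.toAffine.Point) (c : ℚ) {e₁ e₂ lg : ℚ_[p]} (he₁ : e₁ ≠ 0) (he₂ : e₂ ≠ 0)
    (L₂ : PowerSeries ℚ_[p])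
    (hL : W.leadingLCoeff = (((c : ℝ) * plusPeriod f * regulatorOf P : ℝ) : ℂ))
    (h₁ : PowerSeries.coeff 2 (padicLFunction f (unitRoot W p : ℚ_[p])) * lg ^ 2 =
      (c : ℚ_[p]) * e₁ * padicRegulatorOf D₁ P)
    (h₂ : PowerSeries.coeff 2 L₂ * lg ^ 2 = (c : ℚ_[p]) * e₂ * padicRegulatorOf D₂ P)
    (hKato₂ : (W.selmerCorank p : ℕ∞) ≤ L₂.order) (hF : soloFineHeightOf D₁ ℓ P ≠ 0) :
    W.mordellWeilRank = 2 ∧ W.shaCorank p = 0 :=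
  soloInformedPencil_rank_eq W p f hE hp hord hf hKato h ht P c he₁ he₂ L₂ hL h₁ h₂ hKato₂
    (soloInformedFine_noRadical_of_ne_zero D₁ ℓ P hF)

/-- The same, read as the summit equality for this curve when `r_an(E) = 2`. [folklore] -/
theorem soloInformedFine_analyticRank_eq (hE : hasEntireLFunction_rat) (hp : 5 ≤ p)
    (hord : IsOrdinaryAt W p) (hf : IsNewformOf W f) (hr : W.analyticRank = 2)
    (hKato : kato_selmerCorank_le_order_padicLFunction W p (f := f))
    {D₁ D₂ : WeierstrassCurve.PAdicHeightData W p} {ℓ : W.toAffine.Point →+ ℚ_[p]} {t : ℚ_[p]}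
    (h : ∀ P Q, D₂.pairing P Q = D₁.pairing P Q - t * ℓ P * ℓ Q) (ht : t ≠ 0)
    (P : Fin 2 → W.toAffine.Point) (c : ℚ) {e₁ e₂ lg : ℚ_[p]} (he₁ : e₁ ≠ 0) (he₂ : e₂ ≠ 0)
    (L₂ : PowerSeries ℚ_[p])
    (hL : W.leadingLCoeff = (((c : ℝ) * plusPeriod f * regulatorOf P : ℝ) : ℂ))
    (h₁ : PowerSeries.coeff 2 (padicLFunction f (unitRoot W p : ℚ_[p])) * lg ^ 2 =
      (c : ℚ_[p]) * e₁ * padicRegulatorOf D₁ P)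
    (h₂ : PowerSeries.coeff 2 L₂ * lg ^ 2 = (c : ℚ_[p]) * e₂ * padicRegulatorOf D₂ P)
    (hKato₂ : (W.selmerCorank p : ℕ∞) ≤ L₂.order) (hF : soloFineHeightOf D₁ ℓ P ≠ 0) :
    W.analyticRank = W.mordellWeilRank := by
  rw [hr, (soloInformedFine_rank_eq_two W p f hE hp hord hf hKato h ht P c he₁ he₂ L₂ hL h₁ h₂
    hKato₂ hF).1]

/-- **Excess rank kills the canonical regulator AND the fine height at every good ordinary prime.**
Data as above at `r = 2`; if `rank E(ℚ) > 2` then `Reg_{D₁}(P) = 0` and `FH_{D₁}(P) = 0`.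
[cite: BuyukbodukPollackSasaki2018, Thm. 1.1.6] -/
theorem soloInformedFine_of_lt (hE : hasEntireLFunction_rat) (hp : 5 ≤ p)
    (hord : IsOrdinaryAt W p) (hf : IsNewformOf W f)
    (hKato : kato_selmerCorank_le_order_padicLFunction W p (f := f))
    {D₁ D₂ : WeierstrassCurve.PAdicHeightData W p} {ℓ : W.toAffine.Point →+ ℚ_[p]} {t : ℚ_[p]}
    (h : ∀ P Q, D₂.pairing P Q = D₁.pairing P Q - t * ℓ P * ℓ Q) (ht : t ≠ 0)
    (P : Fin 2 → W.toAffine.Point) (c : ℚ) {e₁ e₂ lg : ℚ_[p]} (he₁ : e₁ ≠ 0) (he₂ : e₂ ≠ 0)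
    (L₂ : PowerSeries ℚ_[p])
    (hL : W.leadingLCoeff = (((c : ℝ) * plusPeriod f * regulatorOf P : ℝ) : ℂ))
    (h₁ : PowerSeries.coeff 2 (padicLFunction f (unitRoot W p : ℚ_[p])) * lg ^ 2 =
      (c : ℚ_[p]) * e₁ * padicRegulatorOf D₁ P)
    (h₂ : PowerSeries.coeff 2 L₂ * lg ^ 2 = (c : ℚ_[p]) * e₂ * padicRegulatorOf D₂ P)
    (hKato₂ : (W.selmerCorank p : ℕ∞) ≤ L₂.order) (hlt : 2 < W.mordellWeilRank) :
    padicRegulatorOf D₁ P = 0 ∧ soloFineHeightOf D₁ ℓ P = 0 := by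
  obtain ⟨x, hx, hBx, hvx⟩ := soloInformedPencil_common_radical_of_lt W p f hE hp hord hf hKato h
    ht P c he₁ he₂ L₂ hL h₁ h₂ hKato₂ hlt
  exact (soloInformedFine_iff h ht P).mp
    (soloInformedPencil_padicRegulatorOf_eq_zero_of_common_radical h P hx hBx hvx)

end OneCurve

end Summit.BirchSwinnertonDyer.BirchSwinnertonDyer.Theorems

end
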